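import Mathlib
import HarnessLib
import Literature.NumberTheory.DiophantineGeometry.ConicParametrisationAlgebra

/-!
# Rational points on a diagonal conic: the parametrisation is a bijection up to sign

Continues `ConicParametrisationAlgebra.lean` (Browning–Van Valckenborgh 2012, §3, by the
classical projection argument). Fix a nondegenerate diagonal form `F` (`A₀A₁A₂ ≠ 0`), a primitive
zero `P ∈ ℤ³` and a unimodular completion `det(P, e₁, e₂) = 1`. For a primitive `v ∈ ℤ²` put
`Ψ(v)` = the primitive part (`primPart`) of `conicMap A P (v₁e₁ + v₂e₂)`. This file proves:

* `conicMap_comb_ne_zero` — `conicMap A P (se₁ + te₂) ≠ 0` for `(s,t) ≠ 0` (orthogonal zeros are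
  proportional, and `se₁ + te₂` has `P`-coordinate `0`);
* `param_inj` — `Ψ(v) = ±Ψ(v')` forces `v' = ±v` (the `(e₁,e₂)`-coordinates of
  `conicMap A P (v₁e₁+v₂e₂)` are `−2⟨u,P⟩ v`, `conicMap_comb`; the tangent direction
  `⟨se₁+te₂, P⟩ = 0` has one primitive solution up to sign, `eq_or_eq_neg_of_lin_eq_zero`);
* `param_surj` — every primitive zero `x` is `±Ψ(v)` for a primitive `v` (write
  `x = kP + se₁ + te₂`; then `conicMap A P (se₁+te₂) = conicMap A P x = −2⟨x,P⟩ x`);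
* `ncard_param_eq` — **the counting identity**: for a sign-symmetric set `S` of primitive zeros,
  `#{v primitive : Ψ(v) ∈ S} = #S` (an explicit bijection: `v ↦ Ψ(v)` on "positive" `v`,
  `v ↦ −Ψ(v)` on the others).

Everything is proved; the one definition is `primPart x = x / gcd(x)`.

## References

* T. D. Browning, K. Van Valckenborgh, *Sums of three squareful numbers*, Exp. Math. 21 (2012)
  204–211, §3. [cite: BrowningValckenborgh2012, §3]
-/

namespace Literature.NumberTheory.DiophantineGeometry

/-! ## Primitive parts -/

/-- The primitive part `x / gcd(x₀,x₁,x₂)` of an integer vector (`0` for `x = 0`). [folklore] -/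
def primPart (x : ℤ × ℤ × ℤ) : ℤ × ℤ × ℤ :=
  (x.1 / content3 x, x.2.1 / content3 x, x.2.2 / content3 x)

/-- `x = content3 x • primPart x`. [folklore] -/
theorem content3_smul_primPart (x : ℤ × ℤ × ℤ) : (content3 x : ℤ) • primPart x = x := by
  obtain ⟨h1, h2, h3⟩ := content3_dvd x
  ext <;> simp [primPart, Int.mul_ediv_cancel' h1, Int.mul_ediv_cancel' h2,
    Int.mul_ediv_cancel' h3]

/-- The primitive part of a non-zero vector has content `1`. [folklore] -/
theorem content3_primPart {x : ℤ × ℤ × ℤ} (hx : x ≠ 0) : content3 (primPart x) = 1 := by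
  have h := content3_zsmul (content3 x : ℤ) (primPart x)
  rw [content3_smul_primPart, Int.natAbs_natCast] at h
  have h0 : 0 < content3 x := Nat.pos_of_ne_zero fun h0 => hx ((content3_eq_zero_iff x).1 h0)
  have : content3 x * content3 (primPart x) = content3 x * 1 := by rw [mul_one]; exact h.symm
  exact Nat.eq_of_mul_eq_mul_left h0 this

/-- `primPart x = x` when `content3 x = 1`. [folklore] -/
theorem primPart_of_content3_eq_one {x : ℤ × ℤ × ℤ} (hx : content3 x = 1) : primPart x = x := by
  have := content3_smul_primPart x
  rwa [hx, Nat.cast_one, one_smul] at this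

/-- `primPart (c • x) = sign(c) • x` for `c ≠ 0` and `x` of content `1`. [folklore] -/
theorem primPart_zsmul_of_content3_eq_one {c : ℤ} (hc : c ≠ 0) {x : ℤ × ℤ × ℤ}
    (hx : content3 x = 1) : primPart (c • x) = c.sign • x := by
  have hcx : content3 (c • x) = c.natAbs := by rw [content3_zsmul, hx, mul_one]
  have hc' : (c.natAbs : ℤ) ≠ 0 := by exact_mod_cast Int.natAbs_ne_zero.2 hc
  have key : ∀ z : ℤ, c * z / (c.natAbs : ℤ) = c.sign * z := fun z =>
    Int.ediv_eq_of_eq_mul_left hc' (by rw [mul_right_comm, Int.sign_mul_natAbs])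
  ext <;> simp only [primPart, hcx, Prod.smul_fst, Prod.smul_snd, smul_eq_mul, key]

/-- The form vanishes on `primPart x` iff it vanishes on `x` (`x ≠ 0`). [folklore] -/
theorem ternForm_primPart_eq_zero {A x : ℤ × ℤ × ℤ} (hx : x ≠ 0) (h : ternForm A x = 0) :
    ternForm A (primPart x) = 0 := by
  have h0 : (content3 x : ℤ) ≠ 0 := by
    exact_mod_cast fun h0 => hx ((content3_eq_zero_iff x).1 h0)
  have := ternForm_zsmul A (content3 x) (primPart x)
  rw [content3_smul_primPart, h] at this
  exact (mul_eq_zero.1 this.symm).resolve_left (pow_ne_zero 2 h0)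

/-- If `n ∣ c xᵢ` for all `i` and `x` has content `1` then `n ∣ c`. [folklore] -/
theorem dvd_of_dvd_smul_of_content3_eq_one {n : ℕ} {c : ℤ} {x : ℤ × ℤ × ℤ} (hx : content3 x = 1)
    (h1 : (n : ℤ) ∣ c * x.1) (h2 : (n : ℤ) ∣ c * x.2.1) (h3 : (n : ℤ) ∣ c * x.2.2) : (n : ℤ) ∣ c := by
  have h := dvd_content3 (x := c • x) (by simpa using h1) (by simpa using h2) (by simpa using h3)
  rw [content3_zsmul, hx, mul_one] at h
  exact Int.dvd_natAbs.1 (Int.natCast_dvd_natCast.2 h)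

/-! ## Primitive vectors of `ℤ²` -/

/-- Two proportional primitive vectors of `ℤ²` agree up to sign: `c v = c' v'` with `c ≠ 0`,
`gcd(v) = gcd(v') = 1` forces `v' = v` or `v' = −v`. [folklore] -/
theorem eq_or_eq_neg_of_smul_eq_smul {c c' : ℤ} {v v' : ℤ × ℤ} (hc : c ≠ 0)
    (hv : Int.gcd v.1 v.2 = 1) (hv' : Int.gcd v'.1 v'.2 = 1) (h : c • v = c' • v') :
    v' = v ∨ v' = -v := by
  have h1 : c * v.1 = c' * v'.1 := by have := congr_arg Prod.fst h; simpa using this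
  have h2 : c * v.2 = c' * v'.2 := by have := congr_arg Prod.snd h; simpa using this
  have hg : Int.gcd (c * v.1) (c * v.2) = Int.gcd (c' * v'.1) (c' * v'.2) := by rw [h1, h2]
  rw [Int.gcd_mul_left, Int.gcd_mul_left, hv, hv', mul_one, mul_one] at hg
  rcases Int.natAbs_eq_natAbs_iff.1 hg with hcc | hcc
  · left
    rw [← hcc] at h1 h2
    ext
    · exact (mul_left_cancel₀ hc h1).symm
    · exact (mul_left_cancel₀ hc h2).symm
  · right
    have hc0 : c' ≠ 0 := by rintro rfl; rw [neg_zero] at hcc; exact hc hcc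
    rw [hcc, neg_mul] at h1 h2
    ext
    · have : c' * v'.1 = c' * (-v.1) := by linarith
      exact mul_left_cancel₀ hc0 this
    · have : c' * v'.2 = c' * (-v.2) := by linarith
      exact mul_left_cancel₀ hc0 this

/-- A primitive vector is non-zero. [folklore] -/
theorem ne_zero_of_gcd_eq_one {v : ℤ × ℤ} (hv : Int.gcd v.1 v.2 = 1) : v ≠ 0 := by
  rintro rfl
  simp at hv

/-- For `v ≠ 0` exactly one of `v`, `−v` is *positive* (`v₁ > 0`, or `v₁ = 0` and `v₂ > 0`).
[folklore] -/
theorem pos_or_pos_neg {v : ℤ × ℤ} (hv : v ≠ 0) :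
    (0 < v.1 ∨ (v.1 = 0 ∧ 0 < v.2)) ∨ (0 < (-v).1 ∨ ((-v).1 = 0 ∧ 0 < (-v).2)) := by
  simp only [Prod.fst_neg, Prod.snd_neg, Left.neg_pos_iff, neg_eq_zero]
  rcases lt_trichotomy v.1 0 with h | h | h
  · exact Or.inr (Or.inl h)
  · rcases lt_trichotomy v.2 0 with h' | h' | h'
    · exact Or.inr (Or.inr ⟨h, h'⟩)
    · exact absurd (Prod.ext h h') hv
    · exact Or.inl (Or.inr ⟨h, h'⟩)
  · exact Or.inl (Or.inl h)

/-- `v` and `−v` are not both positive. [folklore] -/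
theorem not_pos_and_pos_neg (v : ℤ × ℤ) :
    ¬ ((0 < v.1 ∨ (v.1 = 0 ∧ 0 < v.2)) ∧ (0 < (-v).1 ∨ ((-v).1 = 0 ∧ 0 < (-v).2))) := by
  simp only [Prod.fst_neg, Prod.snd_neg, Left.neg_pos_iff, neg_eq_zero]
  omega

/-- **The primitive solutions of `s m₁ + t m₂ = 0`** (`(m₁, m₂) ≠ 0`) are `± (m₂, −m₁)/gcd`: any two
primitive solutions agree up to sign. [folklore] -/
theorem eq_or_eq_neg_of_lin_eq_zero {m₁ m₂ : ℤ} (hm : (m₁, m₂) ≠ (0, 0)) {v v' : ℤ × ℤ}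
    (hv : Int.gcd v.1 v.2 = 1) (hv' : Int.gcd v'.1 v'.2 = 1)
    (h : v.1 * m₁ + v.2 * m₂ = 0) (h' : v'.1 * m₁ + v'.2 * m₂ = 0) : v' = v ∨ v' = -v := by
  -- `m₂ • v = (v.1 m₂, v.2 m₂) = (v.1 m₂, -v.1 m₁) = v.1 • (m₂, -m₁)` and likewise for `v'`
  by_cases hm2 : m₂ = 0
  · -- then `m₁ ≠ 0` and `v.1 = v'.1 = 0`, `v.2, v'.2 = ±1`
    subst hm2
    have hm1 : m₁ ≠ 0 := fun h0 => hm (by rw [h0])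
    simp only [mul_zero, add_zero, mul_eq_zero, hm1, or_false] at h h'
    rw [h, Int.gcd_zero_left] at hv
    rw [h', Int.gcd_zero_left] at hv'
    rcases Int.natAbs_eq_natAbs_iff.1 (hv.trans hv'.symm) with e | e
    · left; exact Prod.ext (by rw [h, h']) e.symm
    · right; exact Prod.ext (by simp [h, h']) (by simpa using congr_arg Neg.neg e |>.symm)
  · have e1 : m₂ • v = v.1 • ((m₂, -m₁) : ℤ × ℤ) := by
      ext <;> simp; · ring
      · linarith
    have e2 : m₂ • v' = v'.1 • ((m₂, -m₁) : ℤ × ℤ) := by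
      ext <;> simp; · ring
      · linarith
    have hv1 : v.1 ≠ 0 := by
      intro h0
      rw [h0, zero_mul, zero_add, mul_eq_zero] at h
      rcases h with h | h
      · exact ne_zero_of_gcd_eq_one hv (Prod.ext h0 h)
      · exact hm2 h
    have hv1' : v'.1 ≠ 0 := by
      intro h0
      rw [h0, zero_mul, zero_add, mul_eq_zero] at h'
      rcases h' with h' | h'
      · exact ne_zero_of_gcd_eq_one hv' (Prod.ext h0 h')
      · exact hm2 h'
    -- `(v'.1 m₂) • v = (v.1 m₂) • v'`
    have key : (v'.1 * m₂) • v = (v.1 * m₂) • v' := by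
      rw [mul_smul, mul_smul, e1, e2, smul_comm]
    exact eq_or_eq_neg_of_smul_eq_smul (mul_ne_zero hv1' hm2) hv hv' key

section Param

variable {A P e₁ e₂ : ℤ × ℤ × ℤ}

/-! ## The parametrisation `v ↦ conicMap A P (v₁ e₁ + v₂ e₂)` -/

/-- `(e₁, e₂)`-coordinates of `conicMap`: with `u = s e₁ + t e₂`,
`conicMap A P u = F(u) • P + (−2⟨u,P⟩ s) • e₁ + (−2⟨u,P⟩ t) • e₂`. [folklore] -/
theorem conicMap_comb (A P e₁ e₂ : ℤ × ℤ × ℤ) (s t : ℤ) :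
    conicMap A P (s • e₁ + t • e₂) = ternForm A (s • e₁ + t • e₂) • P +
      (-2 * ternBilin A (s • e₁ + t • e₂) P * s) • e₁ +
        (-2 * ternBilin A (s • e₁ + t • e₂) P * t) • e₂ := by
  rw [conicMap_eq_smul_sub_smul]
  simp only [smul_add, smul_smul, sub_eq_add_neg, neg_add, ← neg_smul, add_assoc]
  congr 2 <;> ring_nf

/-- **`conicMap` does not vanish on directions independent of `P`**: if `det(P,e₁,e₂) = 1`,
`A₀A₁A₂ ≠ 0`, `F(P) = 0` and `(s, t) ≠ 0`, then `conicMap A P (s e₁ + t e₂) ≠ 0`. [folklore] -/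
theorem conicMap_comb_ne_zero (hA0 : A.1 ≠ 0) (hA1 : A.2.1 ≠ 0) (hA2 : A.2.2 ≠ 0)
    (hP : ternForm A P = 0) (he : idet3 P e₁ e₂ = 1) {s t : ℤ} (hst : ¬(s = 0 ∧ t = 0)) :
    conicMap A P (s • e₁ + t • e₂) ≠ 0 := by
  intro h0
  set u := s • e₁ + t • e₂ with hu
  have hc := conicMap_comb A P e₁ e₂ s t
  rw [h0, ← hu] at hc
  have hc' : (0 : ℤ) • P + (0 : ℤ) • e₁ + (0 : ℤ) • e₂ = ternForm A u • P +
      (-2 * ternBilin A u P * s) • e₁ + (-2 * ternBilin A u P * t) • e₂ := by simpa using hc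
  obtain ⟨hF, hs, ht⟩ := (comb_eq_comb_iff he _ _ _ _ _ _).1 hc'
  have hL : ternBilin A u P = 0 := by
    by_contra hL
    have hs0 : s = 0 := by
      have := hs.symm; rw [mul_eq_zero] at this
      exact this.resolve_left (mul_ne_zero (by norm_num) hL)
    have ht0 : t = 0 := by
      have := ht.symm; rw [mul_eq_zero] at this
      exact this.resolve_left (mul_ne_zero (by norm_num) hL)
    exact hst ⟨hs0, ht0⟩
  -- `u` and `P` are orthogonal zeros, hence proportional; but `u` has `P`-coordinate `0`
  have hm := minors_eq_zero_of_isotropic hA0 hA1 hA2 hF.symm hP hL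
  -- `Pᵢ • u = uᵢ • P`; the `(e₁,e₂)`-coordinates of `u` are `(s,t)`, those of `P` are `0`
  have hcoord : ∀ c d : ℤ, c • u = d • P → c * s = 0 ∧ c * t = 0 := by
    intro c d hcd
    have e : (0 : ℤ) • P + (c * s) • e₁ + (c * t) • e₂ = d • P + (0 : ℤ) • e₁ + (0 : ℤ) • e₂ := by
      rw [zero_smul, zero_add, zero_smul, zero_smul, add_zero, add_zero, ← hcd, hu, smul_add,
        smul_smul, smul_smul]
    have := (comb_eq_comb_iff he _ _ _ _ _ _).1 e
    exact ⟨this.2.1, this.2.2⟩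
  obtain ⟨h01, h02, h12⟩ := hm
  have hPne : P ≠ 0 := by
    rintro rfl
    simp [idet3] at he
  have key : ∃ c : ℤ, c ≠ 0 ∧ ∃ d : ℤ, c • u = d • P := by
    by_cases h0 : P.1 ≠ 0
    · exact ⟨P.1, h0, u.1, by ext <;> simp <;> nlinarith [h01, h02, h12]⟩
    by_cases h1 : P.2.1 ≠ 0
    · exact ⟨P.2.1, h1, u.2.1, by ext <;> simp <;> nlinarith [h01, h02, h12]⟩
    by_cases h2 : P.2.2 ≠ 0
    · exact ⟨P.2.2, h2, u.2.2, by ext <;> simp <;> nlinarith [h01, h02, h12]⟩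
    push Not at h0 h1 h2
    exact absurd (Prod.ext h0 (Prod.ext h1 h2)) hPne
  obtain ⟨c, hc, d, hcd⟩ := key
  obtain ⟨hs0, ht0⟩ := hcoord c d hcd
  rw [mul_eq_zero] at hs0 ht0
  exact hst ⟨hs0.resolve_left hc, ht0.resolve_left hc⟩

/-- **The tangent direction is non-degenerate**: `(⟨e₁, P⟩, ⟨e₂, P⟩) ≠ (0, 0)` when
`det(P,e₁,e₂) = 1`, `F(P) = 0`, `A₀A₁A₂ ≠ 0` (otherwise `⟨·, P⟩ = 0` identically, i.e. `P = 0`).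
[folklore] -/
theorem bilin_basis_ne_zero (hA0 : A.1 ≠ 0) (hA1 : A.2.1 ≠ 0) (hA2 : A.2.2 ≠ 0)
    (hP : ternForm A P = 0) (he : idet3 P e₁ e₂ = 1) :
    (ternBilin A e₁ P, ternBilin A e₂ P) ≠ (0, 0) := by
  intro h
  simp only [Prod.mk.injEq] at h
  obtain ⟨h1, h2⟩ := h
  have hall : ∀ x : ℤ × ℤ × ℤ, ternBilin A x P = 0 := by
    intro x
    rw [eq_comb_of_idet3_eq_one he x, ternBilin_add_left, ternBilin_add_left,
      ternBilin_zsmul_left, ternBilin_zsmul_left, ternBilin_zsmul_left, ternBilin_self, hP, h1,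
      h2]
    ring
  have e0 := hall (1, 0, 0)
  have e1 := hall (0, 1, 0)
  have e2 := hall (0, 0, 1)
  simp only [ternBilin, mul_one, mul_zero, add_zero, zero_add, zero_mul,
    mul_eq_zero] at e0 e1 e2
  have hPz : P = 0 := Prod.ext (e0.resolve_left hA0) (Prod.ext (e1.resolve_left hA1)
    (e2.resolve_left hA2))
  subst hPz
  simp [idet3] at he

/-- **Injectivity up to sign.** Let `det(P,e₁,e₂) = 1`, `F(P) = 0`, `A₀A₁A₂ ≠ 0`. If two primitive `v, v' ∈ ℤ²` give primitive parts of
`conicMap A P (v₁e₁ + v₂e₂)` equal up to sign, then `v' = ±v`. [folklore] -/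
theorem param_inj (hA0 : A.1 ≠ 0) (hA1 : A.2.1 ≠ 0) (hA2 : A.2.2 ≠ 0)
    (hP : ternForm A P = 0) (he : idet3 P e₁ e₂ = 1) {v v' : ℤ × ℤ}
    (hv : Int.gcd v.1 v.2 = 1) (hv' : Int.gcd v'.1 v'.2 = 1)
    (h : primPart (conicMap A P (v.1 • e₁ + v.2 • e₂)) =
        primPart (conicMap A P (v'.1 • e₁ + v'.2 • e₂)) ∨
      primPart (conicMap A P (v.1 • e₁ + v.2 • e₂)) =
        -primPart (conicMap A P (v'.1 • e₁ + v'.2 • e₂))) :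
    v' = v ∨ v' = -v := by
  set u := v.1 • e₁ + v.2 • e₂ with hu
  set u' := v'.1 • e₁ + v'.2 • e₂ with hu'
  set X := conicMap A P u with hX
  set X' := conicMap A P u' with hX'
  set L := ternBilin A u P with hL
  set L' := ternBilin A u' P with hL'
  have hX0 : X ≠ 0 := conicMap_comb_ne_zero hA0 hA1 hA2 hP he
    (fun h0 => ne_zero_of_gcd_eq_one hv (Prod.ext h0.1 h0.2))
  have hX0' : X' ≠ 0 := conicMap_comb_ne_zero hA0 hA1 hA2 hP he
    (fun h0 => ne_zero_of_gcd_eq_one hv' (Prod.ext h0.1 h0.2))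
  set g := content3 X with hgdef
  set g' := content3 X' with hgdef'
  have hg : (g : ℤ) ≠ 0 := by exact_mod_cast fun h0 => hX0 ((content3_eq_zero_iff X).1 h0)
  have hg' : (g' : ℤ) ≠ 0 := by exact_mod_cast fun h0 => hX0' ((content3_eq_zero_iff X').1 h0)
  have hXd : (g : ℤ) • primPart X = X := content3_smul_primPart X
  have hXd' : (g' : ℤ) • primPart X' = X' := content3_smul_primPart X'
  -- `ε g' X = g X'` for a sign `ε`
  obtain ⟨ε, hε, hεX⟩ : ∃ ε : ℤ, ε ≠ 0 ∧ (ε * g') • X = (g : ℤ) • X' := by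
    rcases h with h | h
    · refine ⟨1, one_ne_zero, ?_⟩
      calc ((1 : ℤ) * g') • X = (g' : ℤ) • ((g : ℤ) • primPart X) := by rw [one_mul, hXd]
        _ = (g : ℤ) • ((g' : ℤ) • primPart X') := by rw [smul_smul, smul_smul, mul_comm, h]
        _ = (g : ℤ) • X' := by rw [hXd']
    · refine ⟨-1, by norm_num, ?_⟩
      calc ((-1 : ℤ) * g') • X = -((g' : ℤ) • ((g : ℤ) • primPart X)) := by
            rw [neg_one_mul, neg_smul, hXd]
        _ = (g : ℤ) • ((g' : ℤ) • primPart X') := by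
            rw [smul_smul, smul_smul, mul_comm, h, smul_neg, neg_neg]
        _ = (g : ℤ) • X' := by rw [hXd']
  -- compare `(e₁,e₂)`-coordinates: `ε g' (−2L) v = g (−2L') v'`
  have hc1 := conicMap_comb A P e₁ e₂ v.1 v.2
  have hc2 := conicMap_comb A P e₁ e₂ v'.1 v'.2
  rw [← hu, ← hX, ← hL] at hc1
  rw [← hu', ← hX', ← hL'] at hc2
  have hcoord : (ε * g' * ternForm A u) • P + (ε * g' * (-2 * L * v.1)) • e₁ +
      (ε * g' * (-2 * L * v.2)) • e₂ =
      ((g : ℤ) * ternForm A u') • P + ((g : ℤ) * (-2 * L' * v'.1)) • e₁ +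
      ((g : ℤ) * (-2 * L' * v'.2)) • e₂ := by
    have := hεX
    rw [hc1, hc2] at this
    simpa only [smul_add, smul_smul] using this
  obtain ⟨-, hs, ht⟩ := (comb_eq_comb_iff he _ _ _ _ _ _).1 hcoord
  by_cases hL0 : L = 0
  · -- tangent case: `L = 0`, then `X = F(u) P`, so `X' ∥ P` and `L' = 0` too
    have hL'0 : L' = 0 := by
      rw [hL0] at hs ht
      simp only [mul_zero, zero_mul] at hs ht
      by_contra hL'0
      have h1 : v'.1 = 0 := by
        have := hs.symm
        rw [mul_eq_zero, mul_eq_zero, mul_eq_zero] at this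
        rcases this with h | (h | h) | h
        · exact absurd h hg
        · norm_num at h
        · exact absurd h hL'0
        · exact h
      have h2 : v'.2 = 0 := by
        have := ht.symm
        rw [mul_eq_zero, mul_eq_zero, mul_eq_zero] at this
        rcases this with h | (h | h) | h
        · exact absurd h hg
        · norm_num at h
        · exact absurd h hL'0
        · exact h
      exact ne_zero_of_gcd_eq_one hv' (Prod.ext h1 h2)
    -- both `v, v'` solve `s ⟨e₁,P⟩ + t ⟨e₂,P⟩ = 0`
    have hlin : ∀ w : ℤ × ℤ, ternBilin A (w.1 • e₁ + w.2 • e₂) P =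
        w.1 * ternBilin A e₁ P + w.2 * ternBilin A e₂ P := by
      intro w; rw [ternBilin_add_left, ternBilin_zsmul_left, ternBilin_zsmul_left]
    refine eq_or_eq_neg_of_lin_eq_zero (bilin_basis_ne_zero hA0 hA1 hA2 hP he) hv hv' ?_ ?_
    · rw [← hlin]; exact hL0
    · rw [← hlin]; exact hL'0
  · have hL'0 : L' ≠ 0 := by
      intro hL'0
      rw [hL'0] at hs ht
      simp only [mul_zero, zero_mul] at hs ht
      have h1 : v.1 = 0 := by
        rw [mul_eq_zero, mul_eq_zero, mul_eq_zero, mul_eq_zero] at hs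
        rcases hs with (h | h) | (h | h) | h
        · exact absurd h hε
        · exact absurd h hg'
        · norm_num at h
        · exact absurd h hL0
        · exact h
      have h2 : v.2 = 0 := by
        rw [mul_eq_zero, mul_eq_zero, mul_eq_zero, mul_eq_zero] at ht
        rcases ht with (h | h) | (h | h) | h
        · exact absurd h hε
        · exact absurd h hg'
        · norm_num at h
        · exact absurd h hL0
        · exact h
      exact ne_zero_of_gcd_eq_one hv (Prod.ext h1 h2)
    have key : (ε * g' * (-2 * L)) • v = ((g : ℤ) * (-2 * L')) • v' := by
      ext <;> simp only [Prod.smul_fst, Prod.smul_snd, smul_eq_mul] <;> linarith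
    exact eq_or_eq_neg_of_smul_eq_smul (mul_ne_zero (mul_ne_zero hε hg')
      (mul_ne_zero (by norm_num) hL0)) hv hv' key

end Param


section Param2

variable {A P e₁ e₂ : ℤ × ℤ × ℤ}

/-- `Int.gcd` of a vector divided by its `gcd` is `1`, also with a sign. [folklore] -/
theorem gcd_div_gcd_neg_div_gcd {a b : ℤ} (h : 0 < Int.gcd a b) :
    Int.gcd (b / Int.gcd a b) (-(a / Int.gcd a b)) = 1 := by
  rw [Int.gcd_neg, Int.gcd_comm]
  exact Int.gcd_div_gcd_div_gcd h

/-- **Surjectivity up to sign.** Let `det(P,e₁,e₂) = 1`, `F(P) = 0`, `P` primitive,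
`A₀A₁A₂ ≠ 0`. Every primitive zero `x` of `F` is `±` the primitive part of
`conicMap A P (v₁e₁ + v₂e₂)` for some primitive `v ∈ ℤ²` (namely the primitive vector along the
`(e₁,e₂)`-coordinates of `x`, or the tangent direction when `x = ±P`). [folklore] -/
theorem param_surj (hA0 : A.1 ≠ 0) (hA1 : A.2.1 ≠ 0) (hA2 : A.2.2 ≠ 0)
    (hP : ternForm A P = 0) (hPc : content3 P = 1) (he : idet3 P e₁ e₂ = 1) {x : ℤ × ℤ × ℤ}
    (hx : ternForm A x = 0) (hxc : content3 x = 1) :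
    ∃ v : ℤ × ℤ, Int.gcd v.1 v.2 = 1 ∧
      (primPart (conicMap A P (v.1 • e₁ + v.2 • e₂)) = x ∨
        primPart (conicMap A P (v.1 • e₁ + v.2 • e₂)) = -x) := by
  set k := idet3 x e₁ e₂ with hk
  set s := idet3 P x e₂ with hs
  set t := idet3 P e₁ x with ht
  have hxk : x = k • P + s • e₁ + t • e₂ := eq_comb_of_idet3_eq_one he x
  by_cases hst : s = 0 ∧ t = 0
  · -- `x = ±P`: use the tangent direction
    obtain ⟨hs0, ht0⟩ := hst
    rw [hs0, ht0, zero_smul, zero_smul, add_zero, add_zero] at hxk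
    set m₁ := ternBilin A e₁ P with hm₁
    set m₂ := ternBilin A e₂ P with hm₂
    have hm : (m₁, m₂) ≠ (0, 0) := bilin_basis_ne_zero hA0 hA1 hA2 hP he
    set gm := Int.gcd m₁ m₂ with hgm
    have hgm0 : 0 < gm := Int.gcd_pos_iff.2 (by
      by_contra h; push Not at h; exact hm (by rw [h.1, h.2]))
    set v : ℤ × ℤ := (m₂ / gm, -(m₁ / gm)) with hv
    have hvg : Int.gcd v.1 v.2 = 1 := gcd_div_gcd_neg_div_gcd hgm0
    refine ⟨v, hvg, ?_⟩
    set u := v.1 • e₁ + v.2 • e₂ with hu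
    have hL : ternBilin A u P = 0 := by
      rw [hu, ternBilin_add_left, ternBilin_zsmul_left, ternBilin_zsmul_left, ← hm₁, ← hm₂, hv]
      simp only
      obtain ⟨m₁', hm₁'⟩ := Int.gcd_dvd_left m₁ m₂
      obtain ⟨m₂', hm₂'⟩ := Int.gcd_dvd_right m₁ m₂
      rw [← hgm] at hm₁' hm₂'
      have hgm0' : (gm : ℤ) ≠ 0 := by exact_mod_cast hgm0.ne'
      conv_lhs => rw [hm₂', hm₁']
      rw [Int.mul_ediv_cancel_left _ hgm0', Int.mul_ediv_cancel_left _ hgm0']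
      ring
    have hXv : conicMap A P u = ternForm A u • P := by
      rw [hu, conicMap_comb, ← hu, hL]; simp
    have hX0 : conicMap A P u ≠ 0 := conicMap_comb_ne_zero hA0 hA1 hA2 hP he
      (fun h0 => ne_zero_of_gcd_eq_one hvg (Prod.ext h0.1 h0.2))
    have hF0 : ternForm A u ≠ 0 := fun h0 => hX0 (by rw [hXv, h0, zero_smul])
    rw [hXv, primPart_zsmul_of_content3_eq_one hF0 hPc]
    -- `k = ±1`
    have hk1 : k = 1 ∨ k = -1 := by
      have := content3_zsmul k P
      rw [← hxk, hxc, hPc, mul_one] at this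
      rcases Int.natAbs_eq_natAbs_iff.1 (show k.natAbs = (1 : ℤ).natAbs by simpa using this.symm)
        with h | h
      · exact Or.inl h
      · exact Or.inr h
    rcases hF0.lt_or_gt with hF | hF <;> rcases hk1 with h1 | h1
    · right; rw [Int.sign_eq_neg_one_of_neg hF, hxk, h1]; simp
    · left; rw [Int.sign_eq_neg_one_of_neg hF, hxk, h1]
    · left; rw [Int.sign_eq_one_of_pos hF, hxk, h1]
    · right; rw [Int.sign_eq_one_of_pos hF, hxk, h1]; simp
  · -- generic case: `v` = primitive vector along `(s, t)`
    set d := Int.gcd s t with hd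
    have hd0 : 0 < d := Int.gcd_pos_iff.2 (by
      by_contra h; push Not at h; exact hst h)
    have hd0' : (d : ℤ) ≠ 0 := by exact_mod_cast hd0.ne'
    obtain ⟨s', hs'⟩ := Int.gcd_dvd_left s t
    obtain ⟨t', ht'⟩ := Int.gcd_dvd_right s t
    rw [← hd] at hs' ht'
    set v : ℤ × ℤ := (s', t') with hv
    have hvg : Int.gcd v.1 v.2 = 1 := by
      have h := Int.gcd_div_gcd_div_gcd hd0
      rw [← hd] at h
      conv_lhs at h => rw [hs', ht', Int.mul_ediv_cancel_left _ hd0', Int.mul_ediv_cancel_left _ hd0']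
      exact h
    refine ⟨v, hvg, ?_⟩
    set u' := v.1 • e₁ + v.2 • e₂ with hu'
    -- `u = s e₁ + t e₂ = x − k P = d u'`
    have hu : s • e₁ + t • e₂ = (d : ℤ) • u' := by
      rw [hu', hv, smul_add, smul_smul, smul_smul, ← hs', ← ht']
    have hux : s • e₁ + t • e₂ = x + (-k) • P := by rw [hxk]; simp [neg_smul]; abel
    have hlam2 : ((d : ℤ) ^ 2) • conicMap A P u' = (-2 * ternBilin A x P) • x := by
      rw [← conicMap_zsmul, ← hu, hux, conicMap_add_zsmul hP, conicMap_self P hx]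
    -- `λ = −2⟨x,P⟩ ≠ 0`
    have hlam2z : -2 * ternBilin A x P ≠ 0 := by
      intro h0
      have hb : ternBilin A x P = 0 := by
        rcases mul_eq_zero.1 h0 with h | h
        · norm_num at h
        · exact h
      have hm := minors_eq_zero_of_isotropic hA0 hA1 hA2 hx hP hb
      rcases eq_or_eq_neg_of_minors_eq_zero hm hxc hPc with hxP | hxP
      · have e : k • P + s • e₁ + t • e₂ = (1 : ℤ) • P + (0 : ℤ) • e₁ + (0 : ℤ) • e₂ := by
          rw [← hxk, hxP]; simp
        obtain ⟨-, h1, h2⟩ := (comb_eq_comb_iff he _ _ _ _ _ _).1 e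
        exact hst ⟨h1, h2⟩
      · have e : k • P + s • e₁ + t • e₂ = (-1 : ℤ) • P + (0 : ℤ) • e₁ + (0 : ℤ) • e₂ := by
          rw [← hxk, hxP]; simp
        obtain ⟨-, h1, h2⟩ := (comb_eq_comb_iff he _ _ _ _ _ _).1 e
        exact hst ⟨h1, h2⟩
    -- `d² ∣ λ`
    have hdvd : (((d ^ 2 : ℕ)) : ℤ) ∣ -2 * ternBilin A x P := by
      have hc : ∀ z : ℤ, (((d ^ 2 : ℕ)) : ℤ) ∣ ((d : ℤ) ^ 2) * z := fun z => ⟨z, by push_cast; ring⟩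
      refine dvd_of_dvd_smul_of_content3_eq_one hxc ?_ ?_ ?_
      · have := congr_arg Prod.fst hlam2
        simp only [Prod.smul_fst, smul_eq_mul] at this
        rw [← this]; exact hc _
      · have := congr_arg (fun w => w.2.1) hlam2
        simp only [Prod.smul_snd, Prod.smul_fst, smul_eq_mul] at this
        rw [← this]; exact hc _
      · have := congr_arg (fun w => w.2.2) hlam2
        simp only [Prod.smul_snd, smul_eq_mul] at this
        rw [← this]; exact hc _
    obtain ⟨lam, hlam⟩ := hdvd
    push_cast at hlam
    rw [hlam, mul_smul] at hlam2
    have hX : conicMap A P u' = lam • x := smul_right_injective _ (pow_ne_zero 2 hd0') hlam2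
    have hlam0 : lam ≠ 0 := by rintro rfl; rw [mul_zero] at hlam; exact hlam2z hlam
    rw [hX, primPart_zsmul_of_content3_eq_one hlam0 hxc]
    rcases hlam0.lt_or_gt with hl | hl
    · right; rw [Int.sign_eq_neg_one_of_neg hl]; simp
    · left; rw [Int.sign_eq_one_of_pos hl]; simp

/-- `conicMap` at `−v`. [folklore] -/
theorem conicMap_comb_neg (A P e₁ e₂ : ℤ × ℤ × ℤ) (v : ℤ × ℤ) :
    conicMap A P ((-v).1 • e₁ + (-v).2 • e₂) = conicMap A P (v.1 • e₁ + v.2 • e₂) := by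
  rw [show (-v).1 • e₁ + (-v).2 • e₂ = -(v.1 • e₁ + v.2 • e₂) by
    simp only [Prod.fst_neg, Prod.snd_neg, neg_smul, neg_add], conicMap_neg]

/-- **The counting identity.** Let `det(P,e₁,e₂) = 1`, `F(P) = 0`, `P` primitive,
`A₀A₁A₂ ≠ 0`, and let `S` be a set of primitive zeros of `F` with `S = −S`. Then the primitive
`v ∈ ℤ²` whose parameter point (the primitive part of `conicMap A P (v₁e₁ + v₂e₂)`) lies in
`S` are exactly as many as the points of `S`: the parametrisation is two-to-one onto the
points of `S` up to sign and hits exactly one of `x, −x`. [folklore] -/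
theorem ncard_param_eq (hA0 : A.1 ≠ 0) (hA1 : A.2.1 ≠ 0) (hA2 : A.2.2 ≠ 0)
    (hP : ternForm A P = 0) (hPc : content3 P = 1) (he : idet3 P e₁ e₂ = 1)
    {S : Set (ℤ × ℤ × ℤ)} (hS : ∀ x ∈ S, ternForm A x = 0 ∧ content3 x = 1)
    (hSneg : ∀ x, x ∈ S ↔ -x ∈ S) :
    {v : ℤ × ℤ | Int.gcd v.1 v.2 = 1 ∧ primPart (conicMap A P (v.1 • e₁ + v.2 • e₂)) ∈ S}.ncard =
      S.ncard := by
  classical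
  set Ψ : ℤ × ℤ → ℤ × ℤ × ℤ := fun v => primPart (conicMap A P (v.1 • e₁ + v.2 • e₂)) with hΨ
  have hΨneg : ∀ v, Ψ (-v) = Ψ v := fun v => by simp only [hΨ, conicMap_comb_neg]
  have hΨ0 : ∀ v : ℤ × ℤ, Int.gcd v.1 v.2 = 1 → Ψ v ≠ 0 := by
    intro v hv h0
    have hX0 := conicMap_comb_ne_zero hA0 hA1 hA2 hP he
      (fun h0 => ne_zero_of_gcd_eq_one hv (Prod.ext h0.1 h0.2))
    have : content3 (Ψ v) = 1 := content3_primPart hX0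
    rw [h0] at this
    simp [content3] at this
  set pos : ℤ × ℤ → Prop := fun v => 0 < v.1 ∨ (v.1 = 0 ∧ 0 < v.2) with hpos
  set Θ : ℤ × ℤ → ℤ × ℤ × ℤ := fun v => if pos v then Ψ v else -Ψ v with hΘ
  refine Set.ncard_congr (fun v _ => Θ v) ?_ ?_ ?_
  · rintro v ⟨hv, hvS⟩
    simp only [hΘ]
    split_ifs
    · exact hvS
    · exact (hSneg _).1 hvS
  · rintro v w ⟨hv, hvS⟩ ⟨hw, hwS⟩ hΘvw
    have hcase : Ψ v = Ψ w ∨ Ψ v = -Ψ w := by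
      simp only [hΘ] at hΘvw
      split_ifs at hΘvw with h1 h2 h2
      · exact Or.inl hΘvw
      · exact Or.inr hΘvw
      · exact Or.inr (by rw [← hΘvw, neg_neg])
      · exact Or.inl (neg_injective hΘvw)
    rcases param_inj hA0 hA1 hA2 hP he hv hw hcase with rfl | rfl
    · rfl
    · -- `w = -v`: then `Θ v = -Θ (-v)`, contradiction
      exfalso
      have hne := not_pos_and_pos_neg v
      have hor := pos_or_pos_neg (ne_zero_of_gcd_eq_one hv)
      simp only [hΘ, hΨneg] at hΘvw
      have h2 : Ψ v ≠ -Ψ v := fun h => hΨ0 v hv (by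
        have : (2 : ℤ) • Ψ v = 0 := by rw [two_smul]; nth_rewrite 2 [h]; exact add_neg_cancel _
        exact (smul_eq_zero.1 this).resolve_left two_ne_zero)
      by_cases hpv : pos v
      · have hpnv : ¬pos (-v) := fun h => hne ⟨hpv, h⟩
        rw [if_pos hpv, if_neg hpnv] at hΘvw
        exact h2 hΘvw
      · have hpnv : pos (-v) := hor.resolve_left hpv
        rw [if_neg hpv, if_pos hpnv] at hΘvw
        exact h2 hΘvw.symm
  · intro x hxS
    obtain ⟨hx, hxc⟩ := hS x hxS
    obtain ⟨v, hv, hvx⟩ := param_surj hA0 hA1 hA2 hP hPc he hx hxc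
    have hvn : Int.gcd (-v).1 (-v).2 = 1 := by simpa using hv
    have hne := not_pos_and_pos_neg v
    have hor := pos_or_pos_neg (ne_zero_of_gcd_eq_one hv)
    change Ψ v = x ∨ Ψ v = -x at hvx
    rcases hvx with hvx | hvx
    · by_cases hpv : pos v
      · refine ⟨v, ⟨hv, ?_⟩, by simp [hΘ, hpv, hvx]⟩
        show Ψ v ∈ S
        rw [hvx]; exact hxS
      · have hpnv : pos (-v) := hor.resolve_left hpv
        refine ⟨-v, ⟨hvn, ?_⟩, by simp only [hΘ, if_pos hpnv, hΨneg, hvx]⟩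
        show Ψ (-v) ∈ S
        rw [hΨneg, hvx]; exact hxS
    · by_cases hpv : pos v
      · have hpnv : ¬pos (-v) := fun h => hne ⟨hpv, h⟩
        refine ⟨-v, ⟨hvn, ?_⟩, by simp only [hΘ, if_neg hpnv, hΨneg, hvx, neg_neg]⟩
        show Ψ (-v) ∈ S
        rw [hΨneg, hvx]; exact (hSneg x).1 hxS
      · refine ⟨v, ⟨hv, ?_⟩, by simp only [hΘ, if_neg hpv, hvx, neg_neg]⟩
        show Ψ v ∈ S
        rw [hvx]; exact (hSneg x).1 hxS

end Param2

end Literature.NumberTheory.DiophantineGeometry
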